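import Summits.CriticalPhenomena.PercolationContinuityZ3.Theorems.PercNearOneGluingNoHeavyLowerTailKNGoodHair
import HarnessLib

/-!
# Kozma–Nitzan GOODNESS for observers whose Steiner neighbours are not lonely
# (`NoHeavyLowerTail` cell, stmt-CriticalPhenomena-4575; prover `prim-hp-2`, deletion–contraction line, gen 3)

Support file (`--supports stmt-CriticalPhenomena-4575`).  No definitions, no named facts, no sorries.
Iterating `KNGoodHair.knGood_mono_pair` from Kozma–Nitzan's Theorem 4:

* `KNGoodNotLonely.real_update_mono_of_isUpperSet` — an increasing event is more likely when one pair weight is raised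
  (one-bond decomposition); `KNGoodNotLonely.real_openConn_mono` — hence `P_{w'}(x ↔ b) ≤ P_w(x ↔ b)` whenever `w' ≤ w` differ on
  finitely many listed pairs (induction on the number of differing pairs).
* `KNGoodNotLonely.knGood_of_notLonely_neighbours` — **let `o ∉ A` have positive-weight pairs only to relays and to the vertices of a
  finite set `X` of non-relays, and let `G₀` be `G` with the pairs `o–X` closed.  If every `x ∈ X` is, in `G₀`, at least as connected to
  `b` as the loneliest relay is in `G` (`min_{a∈A} P_G(a ↔ b) ≤ P_{G₀}(x ↔ b)`), then `(G, A, o, b)` is good** — hence satisfies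
  Kozma–Nitzan's (2) and Conjecture 1 (`KNGood.preFKG2`) — whatever the graph looks like beyond `X`, uniformly in `|A|`, `|X|` and
  the depth/branching of the Steiner structure.  (`G₀`: Theorem 4; then raise the pairs `o–x` one at a time: along the way
  `min_a P(a ↔ b)` only decreases towards its `G₀`-value… precisely, it is at most its `G`-value, and `P(x ↔ b)` is at least its
  `G₀`-value, so the loneliness condition of `knGood_mono_pair` holds at every step.)

In the language of the cell: goodness (hence the linear-rate near-one gluing) holds at every observer all of whose Steiner
children are RELIABLE; the residual of the goodness induction is observers with ≥ 2 LONELY children (one lonely child is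
Kozma–Nitzan's Theorem 5), i.e. the gluing inequality "Conjecture M" of the seat notes.
-/

noncomputable section

namespace Summit.CriticalPhenomena.PercolationContinuityZ3.Theorems

open MeasureTheory Set Literature.Probability.LatticeModels Literature.Probability.Percolation
open scoped Classical BigOperators

variable {n : ℕ}

namespace KNGoodNotLonely

open KNGoodHair

/-- An increasing event is more likely when one pair weight is raised: `t ≤ s ⇒ μ_{w[e↦t]}(S) ≤ μ_{w[e↦s]}(S)`. [folklore] -/
theorem real_update_mono_of_isUpperSet (w : Sym2 (Fin n) → unitInterval) (e : Sym2 (Fin n))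
    {S : Set (BondConfig (Fin n))} (hS : IsUpperSet S) {t s : unitInterval} (hts : t ≤ s) :
    (prodBernoulli (Function.update w e t)).real S ≤ (prodBernoulli (Function.update w e s)).real S := by
  have hdec : ∀ u : unitInterval, (prodBernoulli (Function.update w e u)).real S =
      (1 - (u : ℝ)) * (prodBernoulli (Function.update w e 0)).real S +
        (u : ℝ) * (prodBernoulli (Function.update w e 1)).real S := by
    intro u
    have h := stub_oneBondDecomp_k15 n (Function.update w e u) e S
    rwa [Function.update_idem, Function.update_idem, Function.update_self] at h
  have h01 := tieLiftOne_real_zero_le_one w e hS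
  have hts' : (t : ℝ) ≤ (s : ℝ) := hts
  rw [hdec t, hdec s]
  nlinarith

/-- **Raising weights raises connection probabilities**: if `w' ≤ w` pointwise then `P_{w'}(x ↔ b) ≤ P_w(x ↔ b)`
(induction on the number of pairs where `w'` and `w` differ). [folklore] -/
theorem real_openConn_mono (x b : Fin n) :
    ∀ (m : ℕ) (w w' : Sym2 (Fin n) → unitInterval),
      (Finset.univ.filter fun e : Sym2 (Fin n) => w' e ≠ w e).card = m →
      (∀ e : Sym2 (Fin n), w' e ≤ w e) →
      (prodBernoulli w').real (openConn x b) ≤ (prodBernoulli w).real (openConn x b) := by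
  intro m
  induction m with
  | zero =>
    intro w w' hm _
    have hww : w' = w := by
      funext e
      by_contra hne
      have : e ∈ (Finset.univ.filter fun e : Sym2 (Fin n) => w' e ≠ w e) := Finset.mem_filter.2 ⟨Finset.mem_univ _, hne⟩
      rw [Finset.card_eq_zero] at hm
      rw [hm] at this
      exact Finset.notMem_empty e this
    rw [hww]
  | succ m ih =>
    intro w w' hm hle
    obtain ⟨e, he⟩ := Finset.card_pos.1 (by omega : 0 < (Finset.univ.filter fun e : Sym2 (Fin n) => w' e ≠ w e).card)
    set w'' : Sym2 (Fin n) → unitInterval := Function.update w' e (w e) with hw''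
    have hstep : (prodBernoulli w').real (openConn x b) ≤ (prodBernoulli w'').real (openConn x b) := by
      have h := real_update_mono_of_isUpperSet w' e (isUpperSet_openConn x b) (hle e)
      rwa [Function.update_eq_self] at h
    have hcount : (Finset.univ.filter fun e' : Sym2 (Fin n) => w'' e' ≠ w e').card = m := by
      have hset : (Finset.univ.filter fun e' : Sym2 (Fin n) => w'' e' ≠ w e') =
          (Finset.univ.filter fun e' : Sym2 (Fin n) => w' e' ≠ w e').erase e := by
        ext e'
        simp only [Finset.mem_filter, Finset.mem_univ, true_and, Finset.mem_erase]
        by_cases h : e' = e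
        · subst h; simp [hw'']
        · simp [hw'', h]
      rw [hset, Finset.card_erase_of_mem he, hm]
      rfl
    have hle'' : ∀ e' : Sym2 (Fin n), w'' e' ≤ w e' := by
      intro e'
      by_cases h : e' = e
      · subst h; rw [hw'', Function.update_self]
      · rw [hw'', Function.update_of_ne h]; exact hle e'
    exact hstep.trans (ih w w'' hcount hle'')

/-- **Goodness for observers with non-lonely Steiner neighbours.**  `o ∉ A`, `X` a finite set of non-relay vertices `≠ o`,
every positive-weight pair at `o` goes into `A ∪ X`, `G₀ = G` with the pairs `o–X` closed; if
`min_{a ∈ A} P_G(a ↔ b) ≤ P_{G₀}(x ↔ b)` for every `x ∈ X`, then `(G, A, o, b)` is good.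
[cite: KozmaNitzan2024, Thm. 4 (p. 12), Thm. 5 (p. 13) — extension] -/
theorem knGood_of_notLonely_neighbours (w : Sym2 (Fin n) → unitInterval) (A : Finset (Fin n)) (hA : A.Nonempty)
    (o b : Fin n) (X : Finset (Fin n)) (ho : o ∉ A) (hX : ∀ x ∈ X, x ∉ A ∧ x ≠ o)
    (hiso : ∀ u : Fin n, u ≠ o → u ∉ A → u ∉ X → w s(o, u) = 0)
    (hnl : ∀ x ∈ X, A.inf' hA (fun a => (prodBernoulli w).real (openConn a b)) ≤
      (prodBernoulli (fun e => if ∃ x ∈ X, e = s(o, x) then 0 else w e)).real (openConn x b)) :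
    KNGood w A hA o b := by
  set w₀ : Sym2 (Fin n) → unitInterval := fun e => if ∃ x ∈ X, e = s(o, x) then 0 else w e with hw₀
  -- Theorem 4 at `G₀`
  have hgood₀ : KNGood w₀ A hA o b := by
    refine KozmaNitzan2024_thm4_good w₀ A hA o b ho fun u huo huA => ?_
    by_cases huX : u ∈ X
    · rw [hw₀]; simp only; rw [if_pos ⟨u, huX, rfl⟩]
    · rw [hw₀]; simp only
      rw [if_neg]
      · exact hiso u huo huA huX
      · rintro ⟨x, hx, hux⟩
        exact huX ((Sym2.congr_right.1 hux) ▸ hx)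
  -- the invariant along the raising of the pairs `o–x`: `w' ≤ w`, `w' = w` off the pairs `o–X`, `P_{w₀}(x ↔ b) ≤ P_{w'}(x ↔ b)`
  have key : ∀ (m : ℕ) (w' : Sym2 (Fin n) → unitInterval),
      (Finset.univ.filter fun e : Sym2 (Fin n) => w' e ≠ w e).card = m →
      (∀ e : Sym2 (Fin n), w' e ≠ w e → ∃ x ∈ X, e = s(o, x)) →
      (∀ e : Sym2 (Fin n), w' e ≤ w e) → (∀ e : Sym2 (Fin n), w₀ e ≤ w' e) →
      KNGood w' A hA o b → KNGood w A hA o b := by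
    intro m
    induction m with
    | zero =>
      intro w' hm _ _ _ hgood
      have hww : w' = w := by
        funext e
        by_contra hne
        have : e ∈ (Finset.univ.filter fun e : Sym2 (Fin n) => w' e ≠ w e) :=
          Finset.mem_filter.2 ⟨Finset.mem_univ _, hne⟩
        rw [Finset.card_eq_zero] at hm
        rw [hm] at this
        exact Finset.notMem_empty e this
      rwa [hww] at hgood
    | succ m ih =>
      intro w' hm hdiff hle hge hgood
      obtain ⟨e, he⟩ := Finset.card_pos.1 (by omega : 0 < (Finset.univ.filter fun e : Sym2 (Fin n) => w' e ≠ w e).card)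
      have hne : w' e ≠ w e := (Finset.mem_filter.1 he).2
      obtain ⟨x, hx, rfl⟩ := hdiff e hne
      have hxo : x ≠ o := (hX x hx).2
      set w'' : Sym2 (Fin n) → unitInterval := Function.update w' s(o, x) (w s(o, x)) with hw''
      -- the number of pairs where `w₀` and `w'` differ
      have hcount₀ : ∀ (u : Sym2 (Fin n) → unitInterval), (∀ e, u e ≠ w e → ∃ x ∈ X, e = s(o, x)) →
          (∀ e, w₀ e ≤ u e) →
          (prodBernoulli w₀).real (openConn x b) ≤ (prodBernoulli u).real (openConn x b) := by
        intro u _ hu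
        exact real_openConn_mono x b _ u w₀ rfl hu
      have hgood'' : KNGood w'' A hA o b := by
        have h1 : Function.update w'' s(o, x) (w' s(o, x)) = w' := by
          rw [hw'', Function.update_idem, Function.update_eq_self]
        refine knGood_mono_pair w'' A hA o b x hxo (w' s(o, x)) ?_ (by rw [h1]; exact hgood) ?_
        · rw [hw'', Function.update_self]; exact hle _
        · rw [h1]
          -- `min_a P_{w'}(a ↔ b) ≤ min_a P_w(a ↔ b) ≤ P_{w₀}(x ↔ b) ≤ P_{w'}(x ↔ b)`
          have hm1 : A.inf' hA (fun a => (prodBernoulli w').real (openConn a b)) ≤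
              A.inf' hA (fun a => (prodBernoulli w).real (openConn a b)) := by
            refine (Finset.le_inf'_iff hA _).2 fun a ha => ?_
            exact (Finset.inf'_le _ ha).trans (real_openConn_mono a b _ w w' rfl hle)
          exact hm1.trans ((hnl x hx).trans (hcount₀ w' hdiff hge))
      have hcount : (Finset.univ.filter fun e : Sym2 (Fin n) => w'' e ≠ w e).card = m := by
        have hset : (Finset.univ.filter fun e : Sym2 (Fin n) => w'' e ≠ w e) =
            (Finset.univ.filter fun e : Sym2 (Fin n) => w' e ≠ w e).erase s(o, x) := by
          ext e'
          simp only [Finset.mem_filter, Finset.mem_univ, true_and, Finset.mem_erase]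
          by_cases h : e' = s(o, x)
          · subst h; simp [hw'']
          · simp [hw'', h]
        rw [hset, Finset.card_erase_of_mem he, hm]
        rfl
      refine ih w'' hcount ?_ ?_ ?_ hgood''
      · intro e' hne'
        by_cases h : e' = s(o, x)
        · exact ⟨x, hx, h⟩
        · have : w' e' ≠ w e' := by rwa [hw'', Function.update_of_ne h] at hne'
          exact hdiff e' this
      · intro e'
        by_cases h : e' = s(o, x)
        · subst h; rw [hw'', Function.update_self]
        · rw [hw'', Function.update_of_ne h]; exact hle e'
      · intro e'
        by_cases h : e' = s(o, x)
        · subst h; rw [hw'', Function.update_self]; exact (hge _).trans (hle _)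
        · rw [hw'', Function.update_of_ne h]; exact hge e'
  refine key _ w₀ rfl ?_ ?_ (fun e => le_rfl) hgood₀
  · intro e hne
    by_contra h
    apply hne
    rw [hw₀]; simp only
    rw [if_neg h]
  · intro e
    rw [hw₀]; simp only
    by_cases h : ∃ x ∈ X, e = s(o, x)
    · rw [if_pos h]; exact unitInterval.nonneg _
    · rw [if_neg h]

end KNGoodNotLonely

end Summit.CriticalPhenomena.PercolationContinuityZ3.Theorems

end
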